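import Mathlib.MeasureTheory.Integral.Bochner.Basic
import Mathlib.MeasureTheory.Measure.Haar.OfBasis
import Mathlib.MeasureTheory.Measure.Typeclasses.Finite
import Mathlib.Analysis.InnerProductSpace.PiL2
import Mathlib.LinearAlgebra.Matrix.Determinant.Basic
import Literature.Geometry.Lorentzian.CoordCurvature
import HarnessLib

/-!
# The microlocal defect measure of a Burnett sequence, in consequence form (Huneau–Luk 2024)

For a high-frequency sequence of metrics `gₙ → g₀` in a chart `U ⊆ E ≅ ℝ^{d+1}`
(`BurnettConvergence.lean`), Huneau–Luk (arXiv:2403.03470, Def. 4.1 and (1.5)) define, after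
passing to a subsequence, Radon measures `μ_{αβρσ}` on the cosphere bundle
`S*U = U × ((ℝ^{d+1} ∖ 0)/ℝ₊)` by
`lim ⟨∂_γ h_{αβ}, A ∂_δ h_{ρσ}⟩_{L²(dVol_{g₀})} = ∫_{S*U} a ξ_γ ξ_δ dμ_{αβρσ}` (`h = gₙ − g₀`, `A`
any pseudo-differential operator of order `0` with real principal symbol `a`; existence by
Gérard 1991, Thm. 1 / Tartar 1990, Thm. 1.1, "microlocal defect measures" = "H-measures"), and the
**Vlasov candidate** `μ = g₀^{αρ} g₀^{βσ} (¼ μ_{ρβασ} − ⅛ μ_{ραβσ})` ((1.5)); Theorem 1.5 then says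
that `(U, g₀, μ)` is a (measure) solution of the Einstein–massless-Vlasov system, the Einstein
part reading `∫_U ψ Ric_{μν}(g₀) dVol_{g₀} = ∫_{S*U} ψ ξ_μ ξ_ν dμ` for `ψ ∈ C_c^∞(U)`
(Thm. 1.5 (2)).

Mathlib has no pseudo-differential calculus, so the defining identity is recorded in the
**consequence form obtained by testing with multiplication operators only** (`A = φ·`,
`a(x, ξ) = φ(x)`): contracting Def. 4.1 with (1.5),

  `∫_{S*U} φ(x) ξ_γ ξ_δ dμ = limₙ ∫_U φ · Q_{g₀}(∂_γ hₙ, ∂_δ hₙ) dVol_{g₀}`,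
  `Q_G(β₁, β₂) = ¼ G^{αρ} G^{βσ} (β₁)_{ρβ} (β₂)_{ασ} − ⅛ (tr_G β₁)(tr_G β₂)`

(`Q = −½ P`, `P` the Lindblad–Rodnianski form of HL 2024 (3.14); cf. p. 3:
`∫ ψ Ric = −½ ∫ ψ P(∂h, ∂h) = ∫ ψ ξξ dμ`). This is exactly the part of the identity consumed by
the Einstein equation, and it makes sense for a merely Lipschitz limit `g₀`.

* `MetricCoord.volDensity G x = √|det G_x(eᵢ, eⱼ)|` — the volume density of metric components in
  an orthonormal basis of the (Euclidean) chart space `E` (`dVol_G = volDensity · dx`).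
* `MetricCoord.burnettForm G x β₁ β₂ = Q_G(β₁, β₂)` (above), on bilinear forms `β₁, β₂` (values of
  `∂_v h`), via `sharpAt`, `mtrAt` of `CoordCurvature.lean`; symmetric (`burnettForm_comm`).
* `cosphereSecondMoment μ φ v w = ∫ φ(x) ω(v) ω(w) dμ(x, ω)` — the `φ`-smeared second fibre
  moments of a measure on `E × S(E)` (the effective stress-energy tensor, HL 2019 Remark 4.3).
* `IsBurnettDefectDatum U g g₀ μ` — **`μ` is a defect-measure datum for `(gₙ, g₀)` on `U`**:
  `μ` is a Radon (locally finite Borel) measure on `E × S(E)` living over `U` whose second fibre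
  moments are the limits above, for every `φ ∈ C_c(E)` supported in `U` and all directions
  `v, w ∈ E`.

## Conventions

The cosphere fibre is realised as the Euclidean unit sphere `S(E) = Metric.sphere (0 : E) 1` of the
inner-product (chart) space `E`, a covector class `[ξ]` being represented by `ω = ξ/|ξ|` acting as
`ω(v) = ⟪ω, v⟫`; a "measure on `S*U` acting on positively `2`-homogeneous functions" (HL 2024,
Def. 1.4 (2)) is thereby an honest measure integrating `a(x, ω) ω(v) ω(w)` — the normalisation
`|ξ|² = Σ ξ_α² = 1` of HL 2019, Def. 2.4. Directions of differentiation are vectors `v ∈ E`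
(`∂_v h = fderiv ℝ h x v`), so no basis is chosen. `μ : Measure _` is non-negative by type, as
HL prove for their `μ` under Assumptions 1.2 (Thm. 1.5 (3)); the datum records limits along the
given sequence (apply it to the extracted subsequence).

## What is NOT here

* The full microlocal identity (all `A ∈ Ψ⁰`), equivalently Tartar's Fourier-multiplier form; the
  consequence form does **not** determine `μ` beyond its second fibre moments
  (`TODO(general form)`: state Tartar 1990, Thm. 1.1 with Mathlib's Fourier transform).
* Existence of defect measures (Gérard 1991, Thm. 1), the null-cone support, non-negativity for
  signed candidates and the Vlasov equation (HL 2024, Thm. 1.5 (1), (3), (4)) — theorems about the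
  datum, to be vendored as named facts where a route needs them; the Einstein–massless-Vlasov
  system itself (`EinsteinMasslessVlasovMeasure`, separate definition request).

## References

* C. Huneau, J. Luk, *Burnett's conjecture in generalized wave coordinates*, arXiv:2403.03470,
  Def. 1.4, Thm. 1.5, (1.5), Def. 4.1, Rem. 4.2, (3.14). [HuneauLuk2024wave]
* C. Huneau, J. Luk, *Trilinear compensated compactness and Burnett's conjecture in general
  relativity*, Ann. Sci. ÉNS (2024), arXiv:1907.10743, Def. 2.4, Rem. 4.3, §5 (Def. 5.3,
  Thms. 5.5–5.6). [HuneauLuk2024trilinear]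
* P. Gérard, *Microlocal defect measures*, Comm. PDE 16 (1991) 1761–1794, Thm. 1. [Gerard1991]
* L. Tartar, *H-measures …*, Proc. Roy. Soc. Edinburgh 115A (1990) 193–230, Thm. 1.1. [Tartar1990]
-/

noncomputable section

-- nested operator spaces `E →L[ℝ] E →L[ℝ] E →L[ℝ] ℝ`, as in `CoordCurvature.lean`
set_option maxSynthPendingDepth 3

open Set Filter Topology MeasureTheory
open scoped Topology RealInnerProductSpace

namespace Literature.Geometry.Lorentzian

namespace MetricCoord

variable {E : Type*} [NormedAddCommGroup E] [InnerProductSpace ℝ E]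

/-! ### Huneau–Luk's quadratic form and the volume density -/

/-- **Huneau–Luk's quadratic form** on bilinear forms at `x`, built from the metric components
`G`: `Q_G(β₁, β₂) = ¼ tr((♯β₁) ∘ (♯β₂)) − ⅛ (tr_G β₁)(tr_G β₂)`, i.e.
`¼ G^{αρ} G^{βσ} (β₁)_{ρβ} (β₂)_{σα} − ⅛ G^{αρ}(β₁)_{ρα} G^{βσ}(β₂)_{βσ}` — the contraction (1.5) of
HL 2024 applied to `β₁ ⊗ β₂` (`μ = g₀^{αρ} g₀^{βσ}(¼ μ_{ρβασ} − ⅛ μ_{ραβσ})`), equal to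
`−½ P(G)(β₁, β₂)` for the Lindblad–Rodnianski form `P` of HL 2024, (3.14). Here
`♯ = sharpAt G x`, `tr_G = mtrAt G x`; for symmetric `G x, β₁, β₂` (metric perturbations) all
orderings of the contracted indices agree.
[cite: HuneauLuk2024wave, (1.5)] -/
def burnettForm (G : E → E →L[ℝ] E →L[ℝ] ℝ) (x : E) (β₁ β₂ : E →L[ℝ] E →L[ℝ] ℝ) : ℝ :=
  4⁻¹ * LinearMap.trace ℝ E
      ((((sharpAt G x).comp β₁).comp ((sharpAt G x).comp β₂) : E →L[ℝ] E) : E →ₗ[ℝ] E) -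
    8⁻¹ * (mtrAt G x β₁ * mtrAt G x β₂)

/-- Unfolding lemma for `burnettForm`. [cite: HuneauLuk2024wave, (1.5)] -/
theorem burnettForm_apply (G : E → E →L[ℝ] E →L[ℝ] ℝ) (x : E) (β₁ β₂ : E →L[ℝ] E →L[ℝ] ℝ) :
    burnettForm G x β₁ β₂ =
      4⁻¹ * LinearMap.trace ℝ E
          ((((sharpAt G x).comp β₁).comp ((sharpAt G x).comp β₂) : E →L[ℝ] E) : E →ₗ[ℝ] E) -
        8⁻¹ * (mtrAt G x β₁ * mtrAt G x β₂) := rfl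

/-- `Q_G` is symmetric: `Q_G(β₁, β₂) = Q_G(β₂, β₁)` (`tr(AB) = tr(BA)`; the symmetry (4.1)
`a μ_{αβρσ} = a μ_{ρσαβ}` of HL 2024, Rem. 4.2 (2)). [cite: HuneauLuk2024wave, Remark 4.2 (2)] -/
theorem burnettForm_comm (G : E → E →L[ℝ] E →L[ℝ] ℝ) (x : E) (β₁ β₂ : E →L[ℝ] E →L[ℝ] ℝ) :
    burnettForm G x β₁ β₂ = burnettForm G x β₂ β₁ := by
  simp only [burnettForm_apply]
  rw [mul_comm (mtrAt G x β₁)]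
  congr 2
  exact LinearMap.trace_mul_comm ℝ (((sharpAt G x).comp β₁ : E →L[ℝ] E) : E →ₗ[ℝ] E)
    (((sharpAt G x).comp β₂ : E →L[ℝ] E) : E →ₗ[ℝ] E)

/-- `Q_G(β, 0) = 0`. [cite: HuneauLuk2024wave, (1.5)] -/
@[simp]
theorem burnettForm_zero_right (G : E → E →L[ℝ] E →L[ℝ] ℝ) (x : E) (β : E →L[ℝ] E →L[ℝ] ℝ) :
    burnettForm G x β 0 = 0 := by
  simp [burnettForm_apply, mtrAt]

/-- `Q_G(0, β) = 0`. [cite: HuneauLuk2024wave, (1.5)] -/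
@[simp]
theorem burnettForm_zero_left (G : E → E →L[ℝ] E →L[ℝ] ℝ) (x : E) (β : E →L[ℝ] E →L[ℝ] ℝ) :
    burnettForm G x 0 β = 0 := by
  rw [burnettForm_comm, burnettForm_zero_right]

variable [FiniteDimensional ℝ E]

/-- The **volume density** `√|det G_x(eᵢ, eⱼ)|` of metric components `G` at `x`, the Gram
determinant being taken in the standard orthonormal basis `e = stdOrthonormalBasis ℝ E` of the
Euclidean chart space (independent of the orthonormal basis: `det (Pᵀ M P) = det M` for
orthogonal `P`); `dVol_G = volDensity G · dx` is the measure `dVol_{g₀}` of HL 2024, Thm. 1.5.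
O'Neill 1983, Ch. 7, Lemma 7.19 ff. (volume element `√|det g_{ij}| dx¹⋯dxⁿ`). [folklore] -/
def volDensity (G : E → E →L[ℝ] E →L[ℝ] ℝ) (x : E) : ℝ :=
  Real.sqrt |(Matrix.of fun i j ↦ G x (stdOrthonormalBasis ℝ E i) (stdOrthonormalBasis ℝ E j)).det|

/-- The volume density is non-negative. [folklore] -/
theorem volDensity_nonneg (G : E → E →L[ℝ] E →L[ℝ] ℝ) (x : E) : 0 ≤ volDensity G x :=
  Real.sqrt_nonneg _

end MetricCoord

/-! ### Second fibre moments of a measure on the cosphere bundle -/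

section Cosphere

variable {E : Type*} [NormedAddCommGroup E] [InnerProductSpace ℝ E] [MeasurableSpace E]

/-- The **`φ`-smeared second fibre moment** `∫ φ(x) ω(v) ω(w) dμ(x, ω)` of a measure `μ` on the
(co)sphere bundle `E × S(E)`, `S(E)` the Euclidean unit sphere, `ω(v) = ⟪ω, v⟫`: the right-hand
side `∫_{S*U} a ξ_γ ξ_δ dμ` of HL 2024, Def. 4.1 for `a = φ(x)`, i.e. the effective
stress-energy tensor `T_{γδ} = ∫ ξ_γ ξ_δ dμ_x` paired with `φ` (HL 2019, Remark 4.3).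
[cite: HuneauLuk2024wave, Definition 4.1] -/
def cosphereSecondMoment (μ : Measure (E × Metric.sphere (0 : E) 1)) (φ : E → ℝ) (v w : E) : ℝ :=
  ∫ p, φ p.1 * (⟪(p.2 : E), v⟫ * ⟪(p.2 : E), w⟫) ∂μ

/-- Unfolding lemma for `cosphereSecondMoment`. [cite: HuneauLuk2024wave, Definition 4.1] -/
theorem cosphereSecondMoment_apply (μ : Measure (E × Metric.sphere (0 : E) 1)) (φ : E → ℝ)
    (v w : E) :
    cosphereSecondMoment μ φ v w = ∫ p, φ p.1 * (⟪(p.2 : E), v⟫ * ⟪(p.2 : E), w⟫) ∂μ := rfl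

/-- The second moments are symmetric in the two directions.
[cite: HuneauLuk2024wave, Remark 4.2 (2)] -/
theorem cosphereSecondMoment_comm (μ : Measure (E × Metric.sphere (0 : E) 1)) (φ : E → ℝ)
    (v w : E) :
    cosphereSecondMoment μ φ v w = cosphereSecondMoment μ φ w v := by
  simp only [cosphereSecondMoment_apply, mul_comm ⟪_, v⟫]

/-- The second moments vanish for `φ = 0`. [cite: HuneauLuk2024wave, Definition 4.1] -/
@[simp]
theorem cosphereSecondMoment_zero (μ : Measure (E × Metric.sphere (0 : E) 1)) (v w : E) :
    cosphereSecondMoment μ 0 v w = 0 := by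
  simp [cosphereSecondMoment_apply]

end Cosphere

/-! ### The defect-measure datum of a Burnett sequence -/

section Datum

variable {E : Type*} [NormedAddCommGroup E] [InnerProductSpace ℝ E] [FiniteDimensional ℝ E]
  [MeasurableSpace E] [BorelSpace E]

/-- **`μ` is a (Burnett–Huneau–Luk) defect-measure datum for the sequence `gₙ → g₀` on `U`**,
consequence form of HL 2024, Def. 4.1 with (1.5) (multiplication operators only): `μ` is a Radon
measure on the cosphere bundle `E × S(E)` carried by `U × S(E)`, and for every continuous,
compactly supported `φ` with `tsupport φ ⊆ U` and all directions `v, w ∈ E`,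

  `∫_U φ · Q_{g₀}(∂_v(gₙ − g₀), ∂_w(gₙ − g₀)) · √|det g₀| dx ⟶ ∫ φ(x) ω(v) ω(w) dμ(x, ω)`

as `n → ∞` (`Q = MetricCoord.burnettForm`, `dVol_{g₀} = volDensity g₀ dx`, right-hand side
`cosphereSecondMoment μ φ v w`), i.e.
`∫_{S*U} φ ξ_γ ξ_δ dμ = lim ⟨∂_γ h, φ · (¼ g₀g₀ ∂_δ h − ⅛ …)⟩_{L²(dVol_{g₀})}` with
`μ = g₀^{αρ}g₀^{βσ}(¼ μ_{ρβασ} − ⅛ μ_{ραβσ})`. Every microlocal defect measure of HL 2024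
(Def. 4.1, Rem. 4.2 (1); Gérard 1991, Thm. 1) satisfies this along the extracted subsequence,
and it is the input of the Einstein equation `∫ ψ Ric(g₀) dVol_{g₀} = ∫ ψ ξξ dμ` (Thm. 1.5 (2)); it
does not determine `μ` beyond its second fibre moments (module docstring).
[cite: HuneauLuk2024wave, Definition 4.1] -/
structure IsBurnettDefectDatum (U : Set E) (g : ℕ → E → E →L[ℝ] E →L[ℝ] ℝ)
    (g₀ : E → E →L[ℝ] E →L[ℝ] ℝ) (μ : Measure (E × Metric.sphere (0 : E) 1)) : Prop where
  /-- `μ` is a Radon measure (finite on compact sets; hence regular on this σ-compact space). -/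
  isFiniteMeasureOnCompacts : IsFiniteMeasureOnCompacts μ
  /-- `μ` lives over `U`: the complement of `U × S(E)` is `μ`-null. -/
  measure_compl_prod : μ ((U ×ˢ (univ : Set (Metric.sphere (0 : E) 1)))ᶜ) = 0
  /-- The defining limits: second fibre moments of `μ` = limits of HL's quadratic expressions. -/
  tendsto_secondMoment : ∀ φ : E → ℝ, Continuous φ → HasCompactSupport φ → tsupport φ ⊆ U →
    ∀ v w : E, Tendsto (fun n ↦ ∫ x, φ x *
        (MetricCoord.burnettForm g₀ x (fderiv ℝ (g n - g₀) x v) (fderiv ℝ (g n - g₀) x w) *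
          MetricCoord.volDensity g₀ x)) atTop (𝓝 (cosphereSecondMoment μ φ v w))

namespace IsBurnettDefectDatum

variable {U : Set E} {g : ℕ → E → E →L[ℝ] E →L[ℝ] ℝ} {g₀ : E → E →L[ℝ] E →L[ℝ] ℝ}
  {μ : Measure (E × Metric.sphere (0 : E) 1)}

/-- Along a **stationary** sequence `gₙ = g₀` the quadratic expressions vanish, so a datum has
vanishing second moments: `∫ φ ω(v) ω(w) dμ = 0` for all admissible `φ` (no oscillation, no
effective matter; HL 2024, §1: the limit may well be vacuum).
[cite: HuneauLuk2024wave, Definition 4.1] -/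
theorem cosphereSecondMoment_eq_zero_of_const (h : IsBurnettDefectDatum U (fun _ ↦ g₀) g₀ μ)
    {φ : E → ℝ}
    (hφ : Continuous φ) (hφc : HasCompactSupport φ) (hφU : tsupport φ ⊆ U) (v w : E) :
    cosphereSecondMoment μ φ v w = 0 := by
  have ht := h.tendsto_secondMoment φ hφ hφc hφU v w
  have h0 : (fun n : ℕ ↦ ∫ x, φ x *
      (MetricCoord.burnettForm g₀ x (fderiv ℝ ((fun _ : ℕ ↦ g₀) n - g₀) x v)
        (fderiv ℝ ((fun _ : ℕ ↦ g₀) n - g₀) x w) * MetricCoord.volDensity g₀ x)) =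
      fun _ ↦ 0 := by
    funext n
    simp [sub_self]
  rw [h0] at ht
  exact tendsto_nhds_unique ht tendsto_const_nhds

/-- In particular the **zero measure is a datum for a stationary sequence** on any `U`
(non-vacuity of the notion in the trivial regime). [cite: HuneauLuk2024wave, Definition 4.1] -/
theorem zero_of_const (U : Set E) (g₀ : E → E →L[ℝ] E →L[ℝ] ℝ) :
    IsBurnettDefectDatum U (fun _ ↦ g₀) g₀ 0 where
  isFiniteMeasureOnCompacts := by infer_instance
  measure_compl_prod := by simp
  tendsto_secondMoment φ _ _ _ v w := by
    have h0 : (fun n : ℕ ↦ ∫ x, φ x *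
        (MetricCoord.burnettForm g₀ x (fderiv ℝ ((fun _ : ℕ ↦ g₀) n - g₀) x v)
          (fderiv ℝ ((fun _ : ℕ ↦ g₀) n - g₀) x w) * MetricCoord.volDensity g₀ x)) =
        fun _ ↦ 0 := by
      funext n
      simp [sub_self]
    rw [h0, cosphereSecondMoment_apply, integral_zero_measure]
    exact tendsto_const_nhds

/-- A datum for `(gₙ)` is a datum for the sequence re-indexed along the identity of a shifted
tail: dropping finitely many terms does not change the limits.
[cite: HuneauLuk2024wave, Definition 4.1] -/
theorem comp_add (h : IsBurnettDefectDatum U g g₀ μ) (k : ℕ) :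
    IsBurnettDefectDatum U (fun n ↦ g (n + k)) g₀ μ where
  isFiniteMeasureOnCompacts := h.isFiniteMeasureOnCompacts
  measure_compl_prod := h.measure_compl_prod
  tendsto_secondMoment φ hφ hφc hφU v w :=
    (h.tendsto_secondMoment φ hφ hφc hφU v w).comp (tendsto_add_atTop_nat k)

end IsBurnettDefectDatum

end Datum

end Literature.Geometry.Lorentzian
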